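import Summits.BirchSwinnertonDyer.BirchSwinnertonDyer.Theorems.QuadraticBranchSignedControlPlusEtaNonsurjThetaFunctionalEquationNormCoordinateWeierstrass
import Summits.BirchSwinnertonDyer.BirchSwinnertonDyer.Theorems.QuadraticBranchSignedControlPlusEtaNonsurjThetaFunctionalEquationReciprocityAlgebraic
import HarnessLib

/-!
# Route `QuadraticBranchSignedControl` (rung K8, cell `bsd-potss`), residual crux `PlusEtaMainConjectureNonsurj`
# (stmt-BirchSwinnertonDyer-19606): THE FUNCTIONAL EQUATION ON THE QUADRATIC BRANCH, XXVII — IDEAL LEVEL: HILBERT 90 FOR `ι`, and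
# **EVERY `ι`-STABLE PRINCIPAL IDEAL OF `Λ` IS `(S^{r₀}·N(Z))`** (`p` odd); its Weierstrass polynomial is `T^{r₀}(1+T)^k H(Z)`;
# the ALGEBRAIC twin: `Char X^ε(V/K_∞)^η` in the norm coordinate (granted Kim 3.11η) (seat `bsd-potss-k8eta-c2` g30; kernel, class-wide)

WHY. Parts XXIV–XXVI need the functional equation in the precise form `ι M = w·(1+T)^e·M`. The ALGEBRAIC side of the crux only comes
with the IDEAL form `ι(Char) = Char` (Kim 2008, Thm. 3.11 on the η-component — the hypothesis of Part XXII), i.e. `ι g = u·g` for SOME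
unit `u`. THIS FILE removes the gap for odd `p`: applying `ι` once more gives `u·ιu = 1`, hence `u(0) = ±1`, and then — HILBERT 90 for the
`ℤ/2`-action of `ι` on `Λˣ`, with an EXPLICIT splitting — `v = 1 + u` (resp. `1 − u`) is a unit with `ι(v·g) = v·g` (resp. `= −v·g`):
`u·(1 + ιu) = u + 1`. So EVERY `ι`-stable principal ideal `(g) ≠ 0` has a generator `g' = v·g` with `ι g' = ±g'`, hence (Parts XXIII/XXIV
with `e = 0`) **`(g) = (S^{r₀}·N(Z))`, `N(0) ≠ 0`, `r₀ = ord_T g`**, `μ(g) = μ(N)`, `λ(g) = r₀ + 2λ(N)`, and (Part XXVI) the Weierstrass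
polynomial of `g` is **`T^{r₀}·(1+T)^k·H(Z)`, `H` distinguished of degree `k = λ(N)`** — for ANY Weierstrass datum of `g` itself. Granted
Kim 3.11η (named fact in hypothesis position, as in Part XXII) this applies to every generator of `Char X^ε(V/K_∞)^η` of every row of the
crux: the algebraic `λ` splits as `ord_T + 2k_alg` exactly like the analytic one (Part XXV), and the η-main conjecture of the crux at a row
reads, in the norm coordinate, «`μ_an = μ_alg`, `r₀,an = r₀,alg`, `H_an = H_alg`».

MATHEMATICS. (§79) `ι g = u g`, `g ≠ 0` ⟹ `u·ιu = 1` ⟹ `u(0)² = 1`; `u·ι(1+u) = 1+u`, `u·ι(1−u) = −(1−u)`; `1 ± u ∈ Λˣ` when `u(0) = ±1`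
(`2 ∈ ℤ_pˣ`); `ι((1+u)g) = (1+u)g`, `ι((1−u)g) = −(1−u)g`. (§80) `(ιg) = (g)` ⟹ `∃ v ∈ Λˣ, ε = ±1: ι(vg) = ε·vg = C ε·(1+T)^0·vg`;
Parts XXIV/XXV/XXVI at `e = 0`: `vg = S^{r₀}N(Z)` (`(1+T)^{0·r} = 1`), `(g) = (S^{r₀}N(Z))`, invariants, Weierstrass polynomial (a datum
`g = p^m P U` gives the datum `vg = p^m P (Uv)`). (§81) Kim 3.11η ⟹ `(ι g) = (g)` for generators of `Char X^ε(V/K_∞)^η` (Part XXII's bridge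
`span_invol_eq_of_map_invol_eq`, `EtaSignedSelmerDualData.toLiterature`).

WHAT. §79 `ne_two_of_two_mul_eq_neg_one`, `mul_invol_eq_one_of_invol_eq_mul`, `constantCoeff_sq_eq_one_of_mul_invol_eq_one`, `mul_invol_one_add_eq`, `mul_invol_one_sub_eq`,
`isUnit_one_add_of_constantCoeff_eq_one`, `isUnit_one_sub_of_constantCoeff_eq_neg_one`, **`exists_unit_invol_mul_eq_sign_mul`** (Hilbert 90);
§80 **`exists_unit_normCoordinate_of_span_invol_eq`** (`vg = S^{r₀}N(Z)`, `N(0) ≠ 0`, `μ`, `λ`), **`span_eq_span_sqrtZ_pow_mul_subst_of_span_invol_eq`**,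
**`weierstrass_eq_X_pow_mul_normPoly_of_span_invol_eq`**; §81 `exists_unit_normCoordinate_charGenerator_of_kim`,
`weierstrass_eq_X_pow_mul_normPoly_charGenerator_of_kim` (CONDITIONAL on `Kim2008.thm311_…` in hypothesis position).

HONEST FRAMING (cell `bsd-potss`; FULL-BSD rank ≤ 1 programme, HUMAN RULING D-0036/D-0074): TOOL THEOREMS ONLY — no definition, no
`sorry`, axioms standard; §79–§80 use NO named fact; §81 takes the named fact `Kim2008.thm311_etaSignedSelmerDual_charIdeal_map_invol`
(KimBD 2008 MRL Thm. 3.11 on the η-component; typed in the tree, not proved there) as a HYPOTHESIS — conditional results, nothing discharged;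
nothing about (A), (C1⁺_η), C-cc-1 or `BSD(W,p)` of any pair is claimed; no stub of 19606 is proved; crux and route OPEN; nothing booked.
`--supports stmt-BirchSwinnertonDyer-19606`.

References: [Washington1997] §7.1, §13.2; [MazurTateTeitelbaum1986Invent] §I.17; [GreenbergLNM1716] §1 (pp. 67–68: "`f(T^ι)/f(T)` should be
in `Λ^×`"); [KimBD2008MRL] Thm. 3.11 (p. 93), §1 p. 83; [Kobayashi2003] Thm. 1.3. Tree: Parts XVIII, XXII, XXIII–XXVI.
-/

set_option autoImplicit false
set_option linter.dupNamespace false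
noncomputable section

open scoped Classical MatrixGroups ModularForm Topology

open PowerSeries CongruenceSubgroup WeierstrassCurve Field Literature.NumberTheory.EllipticCurves
  Literature.NumberTheory.EllipticCurves.ModularForms Literature.NumberTheory.GaloisRepresentations ZpExtension
open Literature.NumberTheory.EllipticCurves.IwasawaAlgebra
open Summit.BirchSwinnertonDyer.Rank1Residual.Additive
open Summit.BirchSwinnertonDyer.Rank1Residual.X1.MuLambda (mu lam)

namespace Summit.BirchSwinnertonDyer.BirchSwinnertonDyer.Theorems.EtaThetaFunctionalEquation

variable {p : ℕ} [hp : Fact p.Prime] {r : ℤ_[p]} {S Z : IwasawaAlgebra p}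

/-! ## §79 Hilbert 90 for the involution: `u·ιu = 1 ⟹ u = ±(v/ιv)` with `v = 1 ± u` -/

/-- `2r = −1` is solvable in `ℤ_p` only for odd `p` (`‖2r‖ < 1 = ‖−1‖` in `ℤ_2`). [folklore] -/
theorem ne_two_of_two_mul_eq_neg_one {r : ℤ_[p]} (hr : 2 * r = -1) : p ≠ 2 := by
  rintro rfl
  have h2 : ‖(2 : ℤ_[2])‖ < 1 := (PadicInt.norm_lt_one_iff_dvd _).mpr ⟨1, by norm_num⟩
  have h1 : ‖(2 : ℤ_[2]) * r‖ < 1 := by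
    rw [norm_mul]
    exact mul_lt_one_of_nonneg_of_lt_one_left (norm_nonneg _) h2 (PadicInt.norm_le_one r)
  rw [hr, norm_neg, norm_one] at h1
  exact lt_irrefl _ h1


/-- `ι g = u·g` with `g ≠ 0` forces `u·ιu = 1` (apply `ι` once more; `Λ` is a domain). [cite: GreenbergLNM1716, §1 (pp. 67–68)] -/
theorem mul_invol_eq_one_of_invol_eq_mul {g u : IwasawaAlgebra p} (hg : g ≠ 0) (h : invol p g = u * g) : u * invol p u = 1 := by
  have h2 : g = invol p u * (u * g) := by
    conv_lhs => rw [← invol_invol p g, h, map_mul, h]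
  have h3 : g * (u * invol p u - 1) = 0 := by linear_combination -h2
  exact sub_eq_zero.mp ((mul_eq_zero.mp h3).resolve_left hg)

/-- `u·ιu = 1 ⟹ u(0)² = 1` (`(ιu)(0) = u(0)`). [cite: Washington1997, §13.2] -/
theorem constantCoeff_sq_eq_one_of_mul_invol_eq_one {u : IwasawaAlgebra p} (hu : u * invol p u = 1) : constantCoeff u ^ 2 = 1 := by
  have h := congr_arg constantCoeff hu
  rwa [map_mul, constantCoeff_invol, map_one, ← sq] at h

/-- The explicit Hilbert-90 splitting, sign `+`: `u·ι(1 + u) = 1 + u` when `u·ιu = 1`. [folklore] -/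
theorem mul_invol_one_add_eq {u : IwasawaAlgebra p} (hu : u * invol p u = 1) : u * invol p (1 + u) = 1 + u := by
  rw [map_add, map_one, mul_add, mul_one, hu, add_comm]

/-- The explicit Hilbert-90 splitting, sign `−`: `u·ι(1 − u) = −(1 − u)` when `u·ιu = 1`. [folklore] -/
theorem mul_invol_one_sub_eq {u : IwasawaAlgebra p} (hu : u * invol p u = 1) : u * invol p (1 - u) = -(1 - u) := by
  rw [map_sub, map_one, mul_sub, mul_one, hu, neg_sub]

/-- `1 + u ∈ Λˣ` if `u(0) = 1` and `p` is odd (`(1+u)(0) = 2`). [cite: Washington1997, §7.1] -/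
theorem isUnit_one_add_of_constantCoeff_eq_one (hp2 : p ≠ 2) {u : IwasawaAlgebra p} (h : constantCoeff u = 1) : IsUnit (1 + u) := by
  obtain ⟨r, hr⟩ := exists_two_mul_eq_neg_one (p := p) hp2
  rw [PowerSeries.isUnit_iff_constantCoeff, map_add, map_one, h]
  exact isUnit_iff_exists_inv.mpr ⟨-r, by linear_combination -hr⟩

/-- `1 − u ∈ Λˣ` if `u(0) = −1` and `p` is odd. [cite: Washington1997, §7.1] -/
theorem isUnit_one_sub_of_constantCoeff_eq_neg_one (hp2 : p ≠ 2) {u : IwasawaAlgebra p} (h : constantCoeff u = -1) : IsUnit (1 - u) := by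
  obtain ⟨r, hr⟩ := exists_two_mul_eq_neg_one (p := p) hp2
  rw [PowerSeries.isUnit_iff_constantCoeff, map_sub, map_one, h, sub_neg_eq_add]
  exact isUnit_iff_exists_inv.mpr ⟨-r, by linear_combination -hr⟩

/-- **HILBERT 90 FOR `ι` (odd `p`).** If `ι g = u·g` with `g ≠ 0` then there are a unit `v` and a sign `ε ∈ {1, −1}` (namely `ε = u(0)`,
`v = 1 + εu`... i.e. `1 + u` or `1 − u`) with **`ι(v·g) = ε·(v·g)`**: every `ι`-stable principal ideal has an `ι`-EIGEN generator.
[cite: GreenbergLNM1716, §1 (pp. 67–68)] [cite: Washington1997, §13.2] -/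
theorem exists_unit_invol_mul_eq_sign_mul (hp2 : p ≠ 2) {g u : IwasawaAlgebra p} (hg : g ≠ 0) (h : invol p g = u * g) :
    ∃ (v : IwasawaAlgebra p) (ε : ℤ), IsUnit v ∧ (ε = 1 ∨ ε = -1) ∧
      invol p (v * g) = C ((ε : ℤ) : ℤ_[p]) * binomialSeries ℤ_[p] (0 : ℤ_[p]) * (v * g) := by
  have hu := mul_invol_eq_one_of_invol_eq_mul hg h
  have hsq := constantCoeff_sq_eq_one_of_mul_invol_eq_one hu
  rcases mul_self_eq_one_iff.mp ((sq (constantCoeff u)).symm.trans hsq) with h1 | h1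
  · refine ⟨1 + u, 1, isUnit_one_add_of_constantCoeff_eq_one hp2 h1, Or.inl rfl, ?_⟩
    rw [map_mul, h, ← mul_assoc, mul_comm (invol p (1 + u)) u, mul_invol_one_add_eq hu, binomialSeries_zero, Int.cast_one, map_one,
      one_mul, one_mul]
  · refine ⟨1 - u, -1, isUnit_one_sub_of_constantCoeff_eq_neg_one hp2 h1, Or.inr rfl, ?_⟩
    rw [map_mul, h, ← mul_assoc, mul_comm (invol p (1 - u)) u, mul_invol_one_sub_eq hu, binomialSeries_zero, Int.cast_neg, Int.cast_one,
      map_neg, map_one, mul_one, neg_one_mul, neg_mul]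

/-! ## §80 Every `ι`-stable principal ideal is `(S^{r₀}·N(Z))`; its invariants and Weierstrass polynomial in the norm coordinate -/

/-- **`(ιg) = (g)`, `g ≠ 0`, `p` odd ⟹ `v·g = S^{r₀}·N(Z)`** for a unit `v`, with `N(0) ≠ 0`, `r₀ = ord_T g`, `μ(g) = μ(N)`, `λ(g) = r₀ + 2λ(N)`
(`2r = −1`, `S = T(1+T)^r`, `Z = T + ιT`). No sign / exponent / functional-equation hypothesis beyond the IDEAL form.
[cite: GreenbergLNM1716, §1 (pp. 67–68)] [cite: Washington1997, §7.1, §13.2] -/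
theorem exists_unit_normCoordinate_of_span_invol_eq (hr : 2 * r = -1) (hS : S = X * binomialSeries ℤ_[p] r) (hZ : Z = X + invol p X)
    {g : IwasawaAlgebra p} (hg : g ≠ 0) (hspan : Ideal.span {invol p g} = Ideal.span {g}) :
    ∃ (v N : IwasawaAlgebra p), IsUnit v ∧ constantCoeff N ≠ 0 ∧
      v * g = S ^ (PowerSeries.order g).toNat * PowerSeries.subst Z N ∧ mu g = mu N ∧ lam g = (PowerSeries.order g).toNat + 2 * lam N := by
  have hp2 : p ≠ 2 := ne_two_of_two_mul_eq_neg_one hr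
  obtain ⟨u, hu⟩ := Ideal.span_singleton_eq_span_singleton.mp hspan.symm
  obtain ⟨v, ε, hv, -, hFE⟩ := exists_unit_invol_mul_eq_sign_mul hp2 hg (u := (u : IwasawaAlgebra p)) (by rw [mul_comm]; exact hu.symm)
  have hvg : v * g ≠ 0 := mul_ne_zero hv.ne_zero hg
  obtain ⟨N, hN0, -, hM, hμ, hlam⟩ := exists_normCoordinate_mu_lam_of_invol_eq hr hS hZ hvg hFE
  have hord : PowerSeries.order (v * g) = PowerSeries.order g := by
    rw [order_mul, order_zero_of_unit hv, zero_add]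
  rw [zero_mul, binomialSeries_zero, one_mul, hord] at hM
  rw [hord] at hlam
  have hN : N ≠ 0 := fun h ↦ hN0 (by rw [h, map_zero])
  refine ⟨v, N, hv, hN0, hM, ?_, ?_⟩
  · rw [← hμ, Summit.BirchSwinnertonDyer.Rank1Residual.X1.MuLambda.mu_mul hv.ne_zero hg,
      Summit.BirchSwinnertonDyer.Rank1Residual.X2.mu_eq_zero_of_isUnit hv, zero_add]
  · rw [← hlam, Summit.BirchSwinnertonDyer.Rank1Residual.X1.MuLambda.lam_mul hv.ne_zero hg,
      Summit.BirchSwinnertonDyer.Rank1Residual.X1.ParitySqueeze.lam_eq_zero_of_isUnit hv, zero_add]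

/-- **EVERY `ι`-STABLE PRINCIPAL IDEAL OF `Λ` IS `(S^{r₀}·N(T + ιT))`** (`p` odd): `(ιg) = (g) ≠ 0 ⟹ (g) = (S^{ord_T g}·N(Z))` with
`N(0) ≠ 0`. [cite: GreenbergLNM1716, §1 (pp. 67–68)] [cite: Washington1997, §13.2] -/
theorem span_eq_span_sqrtZ_pow_mul_subst_of_span_invol_eq (hr : 2 * r = -1) (hS : S = X * binomialSeries ℤ_[p] r)
    (hZ : Z = X + invol p X) {g : IwasawaAlgebra p} (hg : g ≠ 0) (hspan : Ideal.span {invol p g} = Ideal.span {g}) :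
    ∃ N : IwasawaAlgebra p, constantCoeff N ≠ 0 ∧
      Ideal.span {g} = Ideal.span {S ^ (PowerSeries.order g).toNat * PowerSeries.subst Z N} := by
  obtain ⟨v, N, hv, hN0, hvg, -, -⟩ := exists_unit_normCoordinate_of_span_invol_eq hr hS hZ hg hspan
  obtain ⟨w, rfl⟩ := hv
  refine ⟨N, hN0, ?_⟩
  rw [← hvg, eq_comm, Ideal.span_singleton_eq_span_singleton]
  exact ⟨w⁻¹, by rw [mul_comm (w : IwasawaAlgebra p) g, mul_assoc, Units.mul_inv, mul_one]⟩

/-- **THE WEIERSTRASS POLYNOMIAL OF AN `ι`-STABLE PRINCIPAL IDEAL IS A NORM**: `(ιg) = (g) ≠ 0`, `p` odd, ANY Weierstrass datum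
`g = p^m·P·U` ⟹ `P = T^{ord_T g}·(1+T)^k·H(Z)` with `H ∈ ℤ_p[Z]` distinguished of degree `k`, `deg P = ord_T g + 2k` (the datum `v·g = p^m·P·(Uv)`
of the `ι`-eigen generator and Part XXVI with `e = 0`). Strengthens Part XVIII (`reciprocal_of_span_invol_eq`).
[cite: Washington1997, §7.1 (Thm. 7.3), §13.2] [cite: GreenbergLNM1716, §1 (pp. 67–68)] -/
theorem weierstrass_eq_X_pow_mul_normPoly_of_span_invol_eq (hr : 2 * r = -1) (hS : S = X * binomialSeries ℤ_[p] r)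
    (hZ : Z = X + invol p X) {g : IwasawaAlgebra p} (hg : g ≠ 0) (hspan : Ideal.span {invol p g} = Ideal.span {g})
    {m : ℕ} {P : Polynomial ℤ_[p]} (hP : P.IsDistinguishedAt (IsLocalRing.maximalIdeal ℤ_[p])) {U : IwasawaAlgebra p} (hU : IsUnit U)
    (hgP : g = C ((p : ℤ_[p]) ^ m) * (P : IwasawaAlgebra p) * U) :
    ∃ H : Polynomial ℤ_[p], H.IsDistinguishedAt (IsLocalRing.maximalIdeal ℤ_[p]) ∧
      P = Polynomial.X ^ (PowerSeries.order g).toNat * ∑ i ∈ Finset.range (H.natDegree + 1),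
        Polynomial.C (H.coeff i) * Polynomial.X ^ (2 * i) * (1 + Polynomial.X) ^ (H.natDegree - i) ∧
      (P : IwasawaAlgebra p) = X ^ (PowerSeries.order g).toNat * (1 + X) ^ H.natDegree * PowerSeries.subst Z (H : IwasawaAlgebra p) ∧
      P.natDegree = (PowerSeries.order g).toNat + 2 * H.natDegree := by
  have hp2 : p ≠ 2 := ne_two_of_two_mul_eq_neg_one hr
  obtain ⟨u, hu⟩ := Ideal.span_singleton_eq_span_singleton.mp hspan.symm
  obtain ⟨v, ε, hv, -, hFE⟩ := exists_unit_invol_mul_eq_sign_mul hp2 hg (u := (u : IwasawaAlgebra p)) (by rw [mul_comm]; exact hu.symm)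
  have hvg : v * g ≠ 0 := mul_ne_zero hv.ne_zero hg
  have hvgP : v * g = C ((p : ℤ_[p]) ^ m) * (P : IwasawaAlgebra p) * (U * v) := by rw [hgP]; ring
  obtain ⟨-, H, -, -, hH, -, -, hPeq, hPZ, hdeg⟩ :=
    weierstrass_eq_X_pow_mul_normPoly_of_invol_eq hr hS hZ hvg hFE hP (hU.mul hv) hvgP
  have hord : PowerSeries.order (v * g) = PowerSeries.order g := by rw [order_mul, order_zero_of_unit hv, zero_add]
  rw [hord] at hPeq hPZ hdeg
  exact ⟨H, hH, hPeq, hPZ, hdeg⟩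

/-! ## §81 The algebraic twin at `Char X^ε(V/K_∞)^η` (granted Kim 3.11η) -/

section Kim

variable (K₀ : Type) [Field K₀] [NumberField K₀] [IsCyclotomicExtension {p} ℚ K₀] [(galRange (K := ℚ) K₀).Normal]
  {ηq : absoluteGaloisGroup ℚ →* ℤˣ} {V : WeierstrassCurve ℚ} [V.IsElliptic] [V.IsGloballyMinimal]
  {κ : ZpExtension ℚ p} {γ : absoluteGaloisGroup ℚ} {ε : ℤˣ}

/-- **`Char X^ε(V/K_∞)^η = (S^{r₀}·N_alg(Z))` with `μ_alg = μ(N_alg)`, `λ_alg = r₀ + 2λ(N_alg)` (granted Kim 3.11η).** Same frame as Part XXII: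
`p ≥ 5` good with `a_p(V) = 0` (every row of the crux), `η` trivial on `Gal(ℚ̄/ℚ(μ_p))`, `κ` cyclotomic with generator `γ ∈ Gal(ℚ̄/K₀)`, ANY dual
datum `D`, ANY nonzero generator `g` of `D.charIdeal`; `2r = −1`, `S = T(1+T)^r`, `Z = T + ιT`. CONDITIONAL on `hKim`.
[cite: KimBD2008MRL, Thm. 3.11 (p. 93), §1 p. 83] [cite: GreenbergLNM1716, §1 (pp. 67–68)] [cite: Washington1997, §7.1, §13.2] -/
theorem exists_unit_normCoordinate_charGenerator_of_kim (hKim : Kim2008.thm311_etaSignedSelmerDual_charIdeal_map_invol)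
    (hη : ∀ σ ∈ galRange (K := ℚ) K₀, ηq σ = 1) (hp5 : 5 ≤ p) (hgood : V.HasGoodReductionAtPrime p)
    (hap : V.frobeniusTrace p = 0) (hκ : κ.IsCyclotomic) (hγ : κ.IsTopGenerator γ) (hγ₀ : γ ∈ galRange (K := ℚ) K₀)
    (D : EtaSignedSelmerDualData V κ K₀ ℚ_[p] ηq γ ε) {g : IwasawaAlgebra p} (hg : D.charIdeal = Ideal.span {g}) (hg0 : g ≠ 0)
    (hr : 2 * r = -1) (hS : S = X * binomialSeries ℤ_[p] r) (hZ : Z = X + invol p X) :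
    ∃ (v N : IwasawaAlgebra p), IsUnit v ∧ constantCoeff N ≠ 0 ∧
      v * g = S ^ (PowerSeries.order g).toNat * PowerSeries.subst Z N ∧ mu g = mu N ∧ lam g = (PowerSeries.order g).toNat + 2 * lam N ∧
      D.charIdeal = Ideal.span {S ^ (PowerSeries.order g).toNat * PowerSeries.subst Z N} := by
  have hmap := hKim p K₀ ηq hη V (by omega) hgood hap κ γ hκ hγ hγ₀ ε D.toLiterature
  rw [EtaSignedSelmerDualData.charIdeal_toLiterature] at hmap
  have hspan := span_invol_eq_of_map_invol_eq hmap hg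
  obtain ⟨v, N, hv, hN0, hvg, hμ, hlam⟩ := exists_unit_normCoordinate_of_span_invol_eq hr hS hZ hg0 hspan
  refine ⟨v, N, hv, hN0, hvg, hμ, hlam, ?_⟩
  obtain ⟨w, rfl⟩ := hv
  rw [hg, ← hvg, eq_comm, Ideal.span_singleton_eq_span_singleton]
  exact ⟨w⁻¹, by rw [mul_comm (w : IwasawaAlgebra p) g, mul_assoc, Units.mul_inv, mul_one]⟩

/-- **THE WEIERSTRASS POLYNOMIAL OF `Char X^ε(V/K_∞)^η` IS A NORM (granted Kim 3.11η)**: for ANY Weierstrass datum `g = p^m·P·U` of a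
nonzero generator `g`: `P = T^{ord_T g}·(1+T)^k·H_alg(Z)`, `H_alg ∈ ℤ_p[Z]` distinguished of degree `k`, `λ_alg = deg P = ord_T g + 2k`.
Strengthens Part XXII (`reciprocal_charGenerator_of_kim`). CONDITIONAL on `hKim`. [cite: KimBD2008MRL, Thm. 3.11 (p. 93)]
[cite: Washington1997, §7.1 (Thm. 7.3), §13.2] -/
theorem weierstrass_eq_X_pow_mul_normPoly_charGenerator_of_kim (hKim : Kim2008.thm311_etaSignedSelmerDual_charIdeal_map_invol)
    (hη : ∀ σ ∈ galRange (K := ℚ) K₀, ηq σ = 1) (hp5 : 5 ≤ p) (hgood : V.HasGoodReductionAtPrime p)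
    (hap : V.frobeniusTrace p = 0) (hκ : κ.IsCyclotomic) (hγ : κ.IsTopGenerator γ) (hγ₀ : γ ∈ galRange (K := ℚ) K₀)
    (D : EtaSignedSelmerDualData V κ K₀ ℚ_[p] ηq γ ε) {g : IwasawaAlgebra p} (hg : D.charIdeal = Ideal.span {g}) (hg0 : g ≠ 0)
    (hr : 2 * r = -1) (hZ : Z = X + invol p X)
    {m : ℕ} {P : Polynomial ℤ_[p]} (hP : P.IsDistinguishedAt (IsLocalRing.maximalIdeal ℤ_[p])) {U : IwasawaAlgebra p} (hU : IsUnit U)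
    (hgP : g = C ((p : ℤ_[p]) ^ m) * (P : IwasawaAlgebra p) * U) :
    ∃ H : Polynomial ℤ_[p], H.IsDistinguishedAt (IsLocalRing.maximalIdeal ℤ_[p]) ∧
      (P : IwasawaAlgebra p) = X ^ (PowerSeries.order g).toNat * (1 + X) ^ H.natDegree * PowerSeries.subst Z (H : IwasawaAlgebra p) ∧
      P.natDegree = (PowerSeries.order g).toNat + 2 * H.natDegree := by
  have hmap := hKim p K₀ ηq hη V (by omega) hgood hap κ γ hκ hγ hγ₀ ε D.toLiterature
  rw [EtaSignedSelmerDualData.charIdeal_toLiterature] at hmap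
  obtain ⟨H, hH, -, hPZ, hdeg⟩ := weierstrass_eq_X_pow_mul_normPoly_of_span_invol_eq hr (S := X * binomialSeries ℤ_[p] r) rfl hZ hg0
    (span_invol_eq_of_map_invol_eq hmap hg) hP hU hgP
  exact ⟨H, hH, hPZ, hdeg⟩

end Kim

end Summit.BirchSwinnertonDyer.BirchSwinnertonDyer.Theorems.EtaThetaFunctionalEquation

end
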